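import Literature.AlgebraicGeometry.Resolution.KummerDegreePResidue
import Literature.AlgebraicGeometry.Resolution.LiftedFrobeniusClosedBasisMixed
import Literature.AlgebraicGeometry.Resolution.NormalDegreePDefectlessGalois
import HarnessLib

/-!
# Prop. 4.13 from a Frobenius-closed basis of the residue function field (Kuhlmann 2010, §4.3)

Topic: `Literature/AlgebraicGeometry/Resolution` (valued function fields). Assembly for the named
fact `Kuhlmann2010Prop413ResidueDegree` (`NormalDegreePDefectlessGalois.lean`) = F.-V. Kuhlmann,
*Elimination of ramification I: The generalized stability theorem*, Trans. AMS 362 (2010)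
5697–5727 = arXiv:1003.5678, **Prop. 4.13** ("In all cases, `[Ē:F̄] = p`"), the mixed
characteristic residue-transcendental leaf of `Kuhlmann2010Stability`
(`GeneralizedStabilityTrustBase.lean`). With

* `DiscreteCoefficientSubfield.lean` (Lemma 4.11: the subfield `K₀`),
* `LiftedFrobeniusClosedBasisMixed.lean` (Lemma 4.11: the dense lifted Frobenius-closed basis),
* `KummerOneUnitsNormalForm.lean` and `KummerDegreePResidue.lean` (Prop. 4.13 over such a basis),

the only input of the printed proof that is not formalised is [K5] Thm. 10 (F.-V. Kuhlmann,
*Additive polynomials and their role in the model theory of valued fields*, Lect. Notes Log. 26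
(2006), Thm. 10; quoted in the proof of Lemma 4.7: "Since `K̄` is assumed to be perfect and `F̄|K̄`
a function field of transcendence degree `1` with `K̄` relatively algebraically closed in `F̄`,
Theorem 10 of [K5] shows that there exists a Frobenius-closed basis of `F̄|K̄`"), in the graded
form `{1} ∪ {s̄ⱼ^{pⁿ}}` in which such bases are constructed
(`Literature/FieldTheory/FunctionField/FrobeniusClosedBasisOfFiltration.lean`). This file proves
Prop. 4.13 from that input, stated for the residue fields of the fields of the class.

## Content (PROVED)

* `Kuhlmann2010Prop413ResidueDegree.of_gradedFrobeniusClosedBasis` — Prop. 4.13 (the named fact)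
  from the existence, for every `F` in the class `IsHenselizedInertiallyGeneratedRT V K` over an
  algebraically closed `K` (in mixed characteristic), of a `Kv`-basis of `Fv` of the graded
  Frobenius-closed form.

## Sources

* F.-V. Kuhlmann, *Elimination of ramification I: The generalized stability theorem*, Trans.
  Amer. Math. Soc. 362 (2010) 5697–5727 = arXiv:1003.5678: §2.2 (Lemma 2.9: `C ∈ K`), §4.2
  (Lemmas 4.7, 4.11), §4.3 (Prop. 4.13). [Kuhlmann2010]
* F.-V. Kuhlmann, Lect. Notes Log. 26 (2006) = arXiv:1003.5683, §5, Thm. 10 (the remaining input).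
-/

noncomputable section

open IsLocalRing

namespace Literature.AlgebraicGeometry.Resolution

universe u

/-- **Kuhlmann 2010, Prop. 4.13 (the named fact `Kuhlmann2010Prop413ResidueDegree`) from
Frobenius-closed bases of the residue function fields.** Hypothesis: for every `(Ω, V)`
algebraically closed of characteristic `0` with `char Ωv = p`, every algebraically closed subfield
`K` and every `F` in the class `IsHenselizedInertiallyGeneratedRT V K`, the extension `Fv|Kv` has
a `Kv`-basis of the graded form `() ↦ 1`, `(j, n) ↦ s̄ⱼ^{pⁿ}` ([K5] Thm. 10 for the function
field `Fv|Kv` of transcendence degree `1` over the algebraically closed `Kv`). Conclusion: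
`[Ev : Fv] = p` for every Galois extension `E|F` of degree `p`. PROVED: `K₀`
(`exists_subfield_discrete_residueSubfield_eq`), the dense lifted basis
(`exists_isDenseLiftedFrobeniusClosedBasis`), `C ∈ K` with `C^{p-1} = -p` and `K = K^p` (`K`
algebraically closed), `vF = vK`, rank one and henselianity of `F` (the class), and
`IsDenseLiftedFrobeniusClosedBasis.relfinrank_residue_eq_of_isGaloisStep`.
[cite: Kuhlmann2010, Prop. 4.13 (with Lemma 4.11 and [K5] Thm. 10)] -/
theorem Kuhlmann2010Prop413ResidueDegree.of_gradedFrobeniusClosedBasis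
    (hFC : ∀ (Ω : Type u) [Field Ω] [IsAlgClosed Ω] [CharZero Ω] (V : ValuationSubring Ω) (p : ℕ)
      [CharP (ResidueField V) p], p.Prime → ∀ (K F : Subfield Ω), IsAlgClosed K →
      IsHenselizedInertiallyGeneratedRT V K F →
      ∃ (J : Type u) (sbar : J → ResidueField V), (∀ j, sbar j ∈ residueSubfield F V) ∧
        LinearIndependent (residueSubfield K V)
          (Sum.elim (fun _ : Unit => (1 : ResidueField V)) (fun jn : J × ℕ => sbar jn.1 ^ p ^ jn.2)) ∧
        ∀ r ∈ residueSubfield F V, r ∈ Submodule.span (residueSubfield K V)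
          (Set.range (Sum.elim (fun _ : Unit => (1 : ResidueField V)) (fun jn : J × ℕ => sbar jn.1 ^ p ^ jn.2)))) :
    Kuhlmann2010Prop413ResidueDegree.{u} := by
  intro Ω _ _ _ V p _ hp K F E hK hF hstep
  haveI : Fact p.Prime := ⟨hp⟩
  -- Lemma 4.11: `K₀` and the dense lifted Frobenius-closed basis
  obtain ⟨K₀, hK₀K, hres, hdisc⟩ := exists_subfield_discrete_residueSubfield_eq (V := V) (p := p) hK
  obtain ⟨J, sbar, hsF, hli, hspan⟩ := hFC Ω V p hp K F hK hF
  obtain ⟨B, hB⟩ := exists_isDenseLiftedFrobeniusClosedBasis hF hK₀K hres hdisc sbar hsF hli hspan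
  -- `C ∈ K` with `C^{p-1} = -p`, and `K = K^p` (K algebraically closed)
  haveI := hK
  obtain ⟨z, hz⟩ := IsAlgClosed.exists_pow_nat_eq (-(p : K)) (by have := hp.two_le; omega : 0 < p - 1)
  have hC : ((z : K) : Ω) ^ (p - 1) = -(p : Ω) := by
    have := congrArg (fun t : K => (t : Ω)) hz
    simpa using this
  have hKroot : ∀ c ∈ K, ∃ d ∈ K, d ^ p = c := by
    intro c hc
    obtain ⟨d, hd⟩ := IsAlgClosed.exists_pow_nat_eq (⟨c, hc⟩ : K) hp.pos
    exact ⟨d, d.2, by have := congrArg (fun t : K => (t : Ω)) hd; simpa using this⟩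
  have hp0 : (p : Ω) ≠ 0 := Nat.cast_ne_zero.mpr hp.ne_zero
  -- `vF = vK`, rank one, henselian
  have hKval : ∀ a ∈ F, a ≠ 0 → ∃ c ∈ K, V.valuation c = V.valuation a := by
    intro a haF ha0
    have hva : V.valuation a ≠ 0 := (map_ne_zero _).mpr ha0
    have hmem : Units.mk0 _ hva ∈ valueSubgroup F V :=
      (mem_valueSubgroup_iff F V _).mpr ⟨⟨a, haF⟩, fun h => ha0 (congrArg Subtype.val h), rfl⟩
    rw [hF.valueSubgroup_eq] at hmem
    obtain ⟨c, -, hc⟩ := (mem_valueSubgroup_iff K V _).mp hmem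
    rw [Units.val_mk0] at hc
    exact ⟨c, c.2, hc.symm⟩
  have hrank : IsRankOneValued V F :=
    hF.isRankOneValued_of_algebraic le_rfl fun a ha => isAlgebraic_algebraMap (⟨a, ha⟩ : F)
  exact hB.relfinrank_residue_eq_of_isGaloisStep hF.isHenselianField z.2 hC hp0 hKroot hKval hrank hstep

end Literature.AlgebraicGeometry.Resolution
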